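import Mathlib.LinearAlgebra.Matrix.Block
import Mathlib.LinearAlgebra.Matrix.NonsingularInverse
import Mathlib.LinearAlgebra.Matrix.Rank
import Literature.InformationTheory.Coding.OnePointAGCodes
import HarnessLib

/-!
# One-point algebraic-geometry codes: Goppa's bound on the dual distance, by the order bound

Continuation of `Literature/InformationTheory/Coding/OnePointAGCodes.lean` (one-point data
`S : OnePointData F R ι`, the codes `S.code a = C(D, aQ)`, `S.genus = #gaps`). We PROVE the last
clause of [Shpilka 2009, App. A, Lemma 22]: "The dual code `C^⊥` has minimum distance at least
`α - (2g - 2)`" — classically `C_L(D, G)^⊥ = C_Ω(D, G)` and `d(C_Ω) ≥ deg G - (2g - 2)`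
[Stichtenoth 2009, Thm. 2.2.7, Thm. 2.2.8], proved there with Weil differentials. Here it is
derived from the one-point data alone by the Feng–Rao / order-bound argument (the standard
alternative proof for one-point codes, cf. Høholdt–van Lint–Pellikaan, *Algebraic geometry
codes*, Handbook of Coding Theory (1998), §4; not held, not relied on for any statement):

* `exists_syn_fn_ne_zero`, `syn_eq_zero_of_deg_lt`: for `y ≠ 0` there is a least pole number `b`
  whose chosen function `f_b` has nonzero syndrome `⟨ev f_b, y⟩` (evaluation is onto), and then the
  syndrome vanishes on all of `L((b-1)Q)`; if `y ⊥ C(D, aQ)` then `b > a`;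
* `card_pairs_le_hammingNorm` (the rank argument): over the `s ≤ b` with `s`, `b - s` both pole
  numbers, the matrix `(⟨ev(f_s f_{b-t}), y⟩)_{s,t}` is lower triangular (`s < t ⇒` pole order
  `< b`) with nonzero diagonal (`f_s f_{b-s} ≡ c f_b mod L((b-1)Q)`, `c ≠ 0`, by rationality of
  `Q`), so it has full rank; it factors as `A · diag(y) · Bᵀ`, so its rank is at most `wt(y)`;
* `add_one_le_card_pairs_add`: at least `b + 1 - 2g` such `s` (each of the `≤ g` gaps spoils at
  most two values of `s`);
* hence `add_two_le_hammingNorm_add_of_dual`: `wt(y) ≥ b + 1 - 2g ≥ a + 2 - 2g`, and the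
  `dualDist` form `le_dualDist_code`.

## References

* A. Shpilka, *Constructions of low-degree and error-correcting ε-biased generators*, comput.
  complexity 18 (2009), Appendix A (V. Guruswami), Lemma 22 (p. 24). Held.
* H. Stichtenoth, *Algebraic Function Fields and Codes*, 2nd ed., GTM 254 (2009), Thm. 1.6.8,
  Thm. 2.2.7, Thm. 2.2.8. Held.
-/

noncomputable section

namespace Literature.InformationTheory.Coding

open Finset Module Matrix

namespace OnePointData

variable {F : Type*} [Field F] {R : Type*} [CommRing R] [Algebra F R] {ι : Type*}
  (S : OnePointData F R ι)

section Syndrome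

variable [Fintype ι]

/-- A nonzero word has a nonzero syndrome against some function of exact pole order (the
evaluation map is onto `F^ι`, and `R` is spanned by such functions). [folklore] -/
theorem exists_syn_fn_ne_zero {y : ι → F} (hy0 : y ≠ 0) :
    ∃ s : ℕ, S.IsPoleNumber s ∧ S.syn y (S.fn s) ≠ 0 := by
  classical
  by_contra h
  push Not at h
  obtain ⟨i, hi⟩ : ∃ i, y i ≠ 0 := by
    by_contra h'
    push Not at h'
    exact hy0 (funext h')
  obtain ⟨f, hf⟩ := S.ev_surjective' (Pi.single i 1)
  have hf0 : f ≠ 0 := by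
    rintro rfl
    have := congr_fun hf i
    simp at this
  obtain ⟨d, hd⟩ := S.exists_deg_eq_coe hf0
  have hker : Submodule.span F (S.fn '' {s | S.IsPoleNumber s ∧ s ≤ d}) ≤
      LinearMap.ker (S.syn y) := by
    refine Submodule.span_le.2 ?_
    rintro _ ⟨s, ⟨hs, -⟩, rfl⟩
    exact h s hs
  have h1 := hker (S.mem_span_fn d f hd.le)
  rw [LinearMap.mem_ker, syn_apply, hf, single_dotProduct, one_mul] at h1
  exact hi h1

/-- If the syndrome vanishes on the chosen functions of all pole orders `< b`, it vanishes on
every function of pole order `< b`. [folklore] -/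
theorem syn_eq_zero_of_deg_lt {y : ι → F} {b : ℕ}
    (h : ∀ s : ℕ, S.IsPoleNumber s → s < b → S.syn y (S.fn s) = 0) {f : R}
    (hf : S.deg f < b) : S.syn y f = 0 := by
  rcases eq_or_ne f 0 with rfl | hf0
  · simp
  obtain ⟨d, hd⟩ := S.exists_deg_eq_coe hf0
  rw [hd] at hf
  have hdb : d < b := by exact_mod_cast hf
  have hker : Submodule.span F (S.fn '' {s | S.IsPoleNumber s ∧ s ≤ d}) ≤
      LinearMap.ker (S.syn y) := by
    refine Submodule.span_le.2 ?_
    rintro _ ⟨s, ⟨hs, hsd⟩, rfl⟩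
    exact h s hs (hsd.trans_lt hdb)
  exact hker (S.mem_span_fn d f hd.le)

end Syndrome

/-- **Counting pairs of pole numbers:** for every `b`, at least `b + 1 - 2g` of the `b + 1`
integers `s ≤ b` have both `s` and `b - s` pole numbers (at most `g` fail each condition).
[cite: Stichtenoth2009, Thm. 1.6.8] -/
theorem add_one_le_card_pairs_add (b : ℕ) (P : Finset ℕ)
    (hP : ∀ s, s ≤ b → S.IsPoleNumber s → S.IsPoleNumber (b - s) → s ∈ P) :
    b + 1 ≤ P.card + 2 * S.genus := by
  classical
  have hcover : Finset.range (b + 1) ⊆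
      P ∪ S.gaps ∪ (Finset.range (b + 1)).filter (fun t => b - t ∈ S.gaps) := by
    intro t ht
    have htb : t ≤ b := Nat.lt_succ_iff.1 (Finset.mem_range.1 ht)
    by_contra hn
    simp only [Finset.mem_union, not_or] at hn
    obtain ⟨⟨h1, h2⟩, h3⟩ := hn
    have h3' : b - t ∉ S.gaps := fun h' => h3 (Finset.mem_filter.2 ⟨ht, h'⟩)
    rw [S.mem_gaps, not_not] at h2 h3'
    exact h1 (hP t htb h2 h3')
  have hle : ((Finset.range (b + 1)).filter fun t => b - t ∈ S.gaps).card ≤ S.genus := by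
    refine Finset.card_le_card_of_injOn (fun t => b - t) (fun t ht => ?_) ?_
    · exact (Finset.mem_filter.1 (Finset.mem_coe.1 ht)).2
    · intro t₁ h₁ t₂ h₂ h
      have h₁' := Finset.mem_range.1 (Finset.mem_filter.1 (Finset.mem_coe.1 h₁)).1
      have h₂' := Finset.mem_range.1 (Finset.mem_filter.1 (Finset.mem_coe.1 h₂)).1
      simp only at h
      omega
  have c1 := Finset.card_le_card hcover
  have c2 := Finset.card_union_le (P ∪ S.gaps)
    ((Finset.range (b + 1)).filter (fun t => b - t ∈ S.gaps))
  have c3 := Finset.card_union_le P S.gaps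
  rw [Finset.card_range] at c1
  have c4 : S.gaps.card = S.genus := rfl
  omega

variable [Fintype ι] [DecidableEq ι] [DecidableEq F]

/-- **The rank argument of the order bound.** If the syndrome of `y` vanishes on all functions of
pole order `< b` but not on `fn b` (`b` a pole number), then `y` has Hamming weight at least the
number of `s ≤ b` with `s` and `b - s` pole numbers: the matrix `(⟨ev(fₛ · f_{b-t}), y⟩)ₛ,ₜ` over
these `s, t` is lower triangular with nonzero diagonal, and factors through `diag(y)`.
[folklore] -/
theorem card_pairs_le_hammingNorm {y : ι → F} {b : ℕ} (hb : S.IsPoleNumber b)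
    (hyb : S.syn y (S.fn b) ≠ 0)
    (hlt : ∀ s : ℕ, S.IsPoleNumber s → s < b → S.syn y (S.fn s) = 0)
    (P : Finset ℕ) (hP : ∀ s ∈ P, s ≤ b ∧ S.IsPoleNumber s ∧ S.IsPoleNumber (b - s)) :
    P.card ≤ hammingNorm y := by
  -- the matrix and its factorisation through `diagonal y`
  let M : Matrix P P F := fun s t => S.syn y (S.fn s * S.fn (b - t))
  let A : Matrix P ι F := fun s k => S.ev (S.fn s) k
  let B : Matrix P ι F := fun t k => S.ev (S.fn (b - t)) k
  have hM : M = A * Matrix.diagonal y * Bᵀ := by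
    ext s t
    rw [Matrix.mul_apply]
    simp only [M, A, B, syn_apply, Matrix.mul_diagonal, Matrix.transpose_apply, dotProduct,
      map_mul, Pi.mul_apply]
    exact Finset.sum_congr rfl fun k _ => by ring
  -- lower triangular
  have htri : M.BlockTriangular OrderDual.toDual := by
    intro s t hst
    have hst' : (s : ℕ) < t := by simpa using hst
    obtain ⟨htb, -, -⟩ := hP t t.2
    obtain ⟨-, hs, -⟩ := hP s s.2
    obtain ⟨-, -, ht⟩ := hP t t.2
    show S.syn y (S.fn s * S.fn (b - t)) = 0
    refine S.syn_eq_zero_of_deg_lt hlt ?_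
    rw [S.deg_mul', S.deg_fn hs, S.deg_fn ht]
    have h' : (s : ℕ) + (b - t) < b := by omega
    exact_mod_cast h'
  -- nonzero diagonal
  have hdiag : ∀ s : P, M s s ≠ 0 := by
    intro s
    obtain ⟨hsb, hs, hs'⟩ := hP s s.2
    have hdeg : S.deg (S.fn s * S.fn (b - s)) = S.deg (S.fn b) := by
      rw [S.deg_mul', S.deg_fn hs, S.deg_fn hs', S.deg_fn hb]
      have h' : (s : ℕ) + (b - s) = b := by omega
      exact_mod_cast h'
    have hne : S.fn s * S.fn (b - s) ≠ 0 := fun h0 => by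
      rw [h0, S.deg_zero, S.deg_fn hb] at hdeg
      exact WithBot.bot_ne_coe hdeg
    obtain ⟨c, hc⟩ := S.exists_deg_sub_smul_lt' _ _ hne hdeg
    rw [hdeg, S.deg_fn hb] at hc
    have h0 := S.syn_eq_zero_of_deg_lt hlt hc
    rw [map_sub, map_smul, smul_eq_mul, sub_eq_zero] at h0
    have hc0 : c ≠ 0 := by
      rintro rfl
      rw [zero_smul, sub_zero, hdeg, S.deg_fn hb] at hc
      exact lt_irrefl _ hc
    show S.syn y (S.fn s * S.fn (b - s)) ≠ 0
    rw [h0]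
    exact mul_ne_zero hc0 hyb
  -- full rank
  have hdet : M.det ≠ 0 := by
    rw [Matrix.det_of_lowerTriangular M htri]
    exact Finset.prod_ne_zero_iff.2 fun s _ => hdiag s
  have hrank : M.rank = P.card := by
    rw [Matrix.rank_of_isUnit M ((Matrix.isUnit_iff_isUnit_det M).2 (isUnit_iff_ne_zero.2 hdet)),
      Fintype.card_coe]
  -- compare with the rank of `diagonal y`
  have hle : M.rank ≤ (Matrix.diagonal y).rank := by
    rw [hM]
    exact (Matrix.rank_mul_le_left _ _).trans (Matrix.rank_mul_le_right _ _)
  rw [hrank, Matrix.rank_diagonal, Fintype.card_subtype] at hle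
  simpa [hammingNorm] using hle

/-- **Goppa's bound on the dual distance of a one-point code** (the residue-code bound
`d(C_Ω(D, aQ)) ≥ a - (2g - 2)`, obtained here by the Feng–Rao order-bound argument): every
nonzero word orthogonal to `C(D, aQ)` has Hamming weight `≥ a + 2 - 2g`.
[cite: Shpilka2009, App. A, Lemma 22 (p. 24)] -/
theorem add_two_le_hammingNorm_add_of_dual {a : ℕ} {y : ι → F}
    (hy : ∀ c ∈ S.code a, c ⬝ᵥ y = 0) (hy0 : y ≠ 0) :
    a + 2 ≤ hammingNorm y + 2 * S.genus := by
  classical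
  -- the least pole number whose chosen function has nonzero syndrome
  have hex : ∃ s : ℕ, S.IsPoleNumber s ∧ S.syn y (S.fn s) ≠ 0 := S.exists_syn_fn_ne_zero hy0
  set b := Nat.find hex with hbdef
  obtain ⟨hb, hyb⟩ : S.IsPoleNumber b ∧ S.syn y (S.fn b) ≠ 0 := Nat.find_spec hex
  have hlt : ∀ s : ℕ, S.IsPoleNumber s → s < b → S.syn y (S.fn s) = 0 := by
    intro s hs hsb
    by_contra hne
    exact Nat.find_min hex hsb ⟨hs, hne⟩
  -- `b > a`: pole orders `≤ a` give codewords
  have hab : a < b := by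
    by_contra hba
    push Not at hba
    refine hyb (hy _ (S.mem_code_iff.2 ⟨S.fn b, ?_, rfl⟩))
    rw [S.deg_fn hb]
    exact_mod_cast hba
  -- the pairs
  set P : Finset ℕ := (Finset.range (b + 1)).filter
    (fun s => S.IsPoleNumber s ∧ S.IsPoleNumber (b - s)) with hPdef
  have h1 : b + 1 ≤ P.card + 2 * S.genus :=
    S.add_one_le_card_pairs_add b P fun s hsb hs hs' =>
      Finset.mem_filter.2 ⟨Finset.mem_range.2 (Nat.lt_succ_of_le hsb), hs, hs'⟩
  have h2 : P.card ≤ hammingNorm y :=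
    S.card_pairs_le_hammingNorm hb hyb hlt P fun s hs => by
      obtain ⟨hsr, hs1, hs2⟩ := Finset.mem_filter.1 hs
      exact ⟨Nat.lt_succ_iff.1 (Finset.mem_range.1 hsr), hs1, hs2⟩
  omega

/-- Goppa's dual-distance bound in terms of `dualDist`: `a + 2 - 2g ≤ d(C(D, aQ)^⊥)`.
[cite: Stichtenoth2009, Thm. 2.2.7 with Thm. 2.2.8] -/
theorem le_dualDist_code (a : ℕ) :
    ((a + 2 - 2 * S.genus : ℕ) : ℕ∞) ≤ dualDist (S.code a) :=
  le_dualDist_iff.2 fun y hy hy0 => by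
    have := S.add_two_le_hammingNorm_add_of_dual hy hy0
    exact_mod_cast (show a + 2 - 2 * S.genus ≤ hammingNorm y by omega)

end OnePointData

end Literature.InformationTheory.Coding

end
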